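import Mathlib
import Summits.KontsevichZagierPeriods.Zeta5Search.Families.DualConstantTermTranslations
import Summits.KontsevichZagierPeriods.Zeta5Search.Families.DualConstantTermStar35
import HarnessLib

/-!
# ζ(5) search — Families: the dual constant term satisfies gen-1's STAR(4,6) — a translation plus a span inclusion

HONEST FRAMING: systematic search; no irrationality claim unless certified.  Cell `pub-zeta5`, certifier 2
(cert-2 g7, 2026-08-21).  Identities between integers; no conjecture node is used; nothing about `ζ(5)`; no number
of record moves.

Second worked instance of the plan `HOME/cert-2/g7/DEXACT-PLAN.md` ("gen-1's STAR relations for the dual constant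
term = translation relations + span inclusions on the torus side"): STAR(4,6) is the translation `T₄`
(`DualCT.coeff_transl4` of `Families/DualConstantTermTranslations`, marked point `w₄`, the only span moved being
`{0,1,2,3}` with exponent `A₆`) taken at the exponent `A + e₆`, combined with the span inclusion
`{0,1,2,3} = {0,1,2} ∪ {3}`, i.e. `dualSpanProd (A+e₆) = dualSpanProd (A+e₇) + g₃·dualSpanProd A`; the identity of
coefficients that makes it gen-1's STAR(4,6) is `P₄ − P₆ = B₃ − A₆` (`P = b(a)`).  No hypothesis beyond the cone.

* `DualCT.dualSpanProd_incl67` — the span inclusion; `DualCT.dualSpanProd_update4` — the exponent `A₄` is invisible;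
* **`DualCT.coeff_star46`** — `(B₃ − A₆)·[g^B]N_A + (B₃+1)·[g^{B+e₃}]N_{A+e₇} − (B₄+1)·[g^{B+e₄}]N_{A+e₆} = 0`
  for ALL `A`, `B`;
* **`dualConstantTerm_star46`** — `(B₃ − A₆)·CT(a) + (B₃+1)·CT(a − s₆) − (B₄+1)·CT(a − s₄) = 0` on the cone;
* **`dualConstantTerm_star46'`** — gen-1's vocabulary: `κ(4,6)·CT(a) + χ₆Π₆·CT(a−s₆) − χ₄Π₄·CT(a−s₄) = 0`
  (common factor `N+1−P₄−P₆ = b₇+1`; two sign changes w.r.t. `DictStar` = the sign of `Q` flipping under both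
  moves — exactly what the signed constant term must satisfy under D-exact; numerically confirmed, `star_test.py`).
-/

noncomputable section
open MvPolynomial Finset

namespace Summit.KontsevichZagierPeriods.Zeta5Search.Families.Cellular
namespace DualCT

/-- Span inclusion `{0,1,2,3} = {0,1,2} ∪ {3}`: `N_{A+e₆} = N_{A+e₇} + g₃·N_A`. -/
theorem dualSpanProd_incl67 (A : Fin 8 → ℕ) :
    dualSpanProd (Function.update A 6 (A 6 + 1)) =
      dualSpanProd (Function.update A 7 (A 7 + 1)) + X 3 * dualSpanProd A := by
  unfold dualSpanProd
  simp only [Function.update_self, Function.update_of_ne (by decide : (0 : Fin 8) ≠ 6),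
    Function.update_of_ne (by decide : (1 : Fin 8) ≠ 6), Function.update_of_ne (by decide : (2 : Fin 8) ≠ 6),
    Function.update_of_ne (by decide : (3 : Fin 8) ≠ 6), Function.update_of_ne (by decide : (7 : Fin 8) ≠ 6),
    Function.update_of_ne (by decide : (0 : Fin 8) ≠ 7), Function.update_of_ne (by decide : (1 : Fin 8) ≠ 7),
    Function.update_of_ne (by decide : (2 : Fin 8) ≠ 7), Function.update_of_ne (by decide : (3 : Fin 8) ≠ 7),
    Function.update_of_ne (by decide : (6 : Fin 8) ≠ 7), pow_succ]
  ring

/-- **STAR(4,6) for the coefficients of the dual span product** = translation `T₄` at `A + e₆` plus the span inclusion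
`N_{A+e₆} = N_{A+e₇} + g₃N_A`:  `(B₃ − A₆)·[g^B]N_A + (B₃+1)·[g^{B+e₃}]N_{A+e₇} − (B₄+1)·[g^{B+e₄}]N_{A+e₆} = 0`
(all `A`, `B`). -/
theorem coeff_star46 (A : Fin 8 → ℕ) (B : Fin 6 →₀ ℕ) :
    ((B 3 : ℤ) - A 6) * coeff B (dualSpanProd A)
      + ((B 3 : ℤ) + 1) * coeff (B + Finsupp.single 3 1) (dualSpanProd (Function.update A 7 (A 7 + 1)))
      - ((B 4 : ℤ) + 1) * coeff (B + Finsupp.single 4 1) (dualSpanProd (Function.update A 6 (A 6 + 1))) = 0 := by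
  have T := coeff_transl4 (Function.update A 6 (A 6 + 1)) B
  simp only [Function.update_self, Function.update_idem, Nat.add_sub_cancel, Function.update_eq_self] at T
  have h3 : (3 : Fin 6) ∈ (B + Finsupp.single 3 1).support := by simp
  have e3 : B + Finsupp.single 3 1 - Finsupp.single 3 1 = B := add_tsub_cancel_right _ _
  have hincl : coeff (B + Finsupp.single 3 1) (dualSpanProd (Function.update A 6 (A 6 + 1))) =
      coeff (B + Finsupp.single 3 1) (dualSpanProd (Function.update A 7 (A 7 + 1))) + coeff B (dualSpanProd A) := by
    rw [dualSpanProd_incl67, coeff_add, coeff_X_mul', if_pos h3, e3]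
  rw [hincl] at T
  push_cast at T ⊢
  linear_combination T

end DualCT

open DualCT
open Summit.KontsevichZagierPeriods.Zeta5Search.WedgeDictionary (slotDown starKappa fanCoeff)
open Literature.NumberTheory.Irrationality
open Literature.NumberTheory.Irrationality.BrownZudilin2022 (bOfA)

/-- `dualSpanProd` does not see the exponent at position 4 (an edge through `∞`). -/
theorem DualCT.dualSpanProd_update4 (A : Fin 8 → ℕ) (v : ℕ) :
    dualSpanProd (Function.update A 4 v) = dualSpanProd A := by
  unfold dualSpanProd
  simp [Function.update_of_ne]

/-- **The dual constant term satisfies gen-1's STAR(4,6)** (divided by the common factor `b₇ + 1 = a₅+a₆−a₈+1` of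
its three coefficients): for `a` with `A = bzNum a ≥ 0`, `B = bzDen a ≥ 0`:
`(B₃ − A₆)·CT(a) + (B₃ + 1)·CT(a − s₆) − (B₄ + 1)·CT(a − s₄) = 0`.  UNCONDITIONAL. -/
theorem dualConstantTerm_star46 (a : Fin 8 → ℤ) (hA : ∀ i, 0 ≤ bzNum a i) (hB : ∀ i, 0 ≤ bzDen a i) :
    (bzDen a 3 - bzNum a 6) * dualConstantTerm a + (bzDen a 3 + 1) * dualConstantTerm (a + slotDown 6)
      - (bzDen a 4 + 1) * dualConstantTerm (a + slotDown 4) = 0 := by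
  set A : Fin 8 → ℕ := fun i => (bzNum a i).toNat with hAdef
  set B : Fin 6 →₀ ℕ :=
    Finsupp.equivFunOnFinite.symm fun w : Fin 6 => (bzDen a (Fin.castLE (by norm_num) w)).toNat with hBdef
  have ha4 : 0 ≤ a 4 := by simpa [bzNum] using hA 4
  have ha5 : 0 ≤ a 5 := by simpa [bzNum] using hA 5
  have ha6 : 0 ≤ a 6 := by simpa [bzNum] using hA 7
  have hA6 : 0 ≤ a 0 + a 4 - a 2 := by simpa [bzNum] using hA 6
  have e0 : dualConstantTerm a = coeff B (dualSpanProd A) := rfl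
  have e6 : dualConstantTerm (a + slotDown 6) =
      coeff (B + Finsupp.single 3 1) (dualSpanProd (Function.update A 7 (A 7 + 1))) := by
    unfold dualConstantTerm
    have hn : (fun i => (bzNum (a + slotDown 6) i).toNat) =
        Function.update (Function.update A 7 (A 7 + 1)) 5 ((bzNum a 5).toNat + 1) := by
      ext i
      fin_cases i <;> simp [hAdef, bzNum, slotDown, Function.update]
      all_goals omega
    have hd : (Finsupp.equivFunOnFinite.symm fun w : Fin 6 =>
          (bzDen (a + slotDown 6) (Fin.castLE (by norm_num) w)).toNat) = B + Finsupp.single 3 1 := by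
      ext w
      have h3' := hB 3
      fin_cases w <;>
        simp [hBdef, bzDen, slotDown, BrownZudilin2022.b24, BrownZudilin2022.b14, BrownZudilin2022.b57,
          BrownZudilin2022.b35, BrownZudilin2022.b36] at * <;> omega
    have hu : dualSpanProd (Function.update (Function.update A 7 (A 7 + 1)) 5 ((bzNum a 5).toNat + 1)) =
        dualSpanProd (Function.update A 7 (A 7 + 1)) := DualCT.dualSpanProd_update5 _ _
    rw [hn, hd, hu]
  have e4 : dualConstantTerm (a + slotDown 4) =
      coeff (B + Finsupp.single 4 1) (dualSpanProd (Function.update A 6 (A 6 + 1))) := by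
    unfold dualConstantTerm
    have hn : (fun i => (bzNum (a + slotDown 4) i).toNat) =
        Function.update (Function.update A 6 (A 6 + 1)) 4 ((bzNum a 4).toNat + 1) := by
      ext i
      fin_cases i <;> simp [hAdef, bzNum, slotDown, Function.update]
      all_goals omega
    have hd : (Finsupp.equivFunOnFinite.symm fun w : Fin 6 =>
          (bzDen (a + slotDown 4) (Fin.castLE (by norm_num) w)).toNat) = B + Finsupp.single 4 1 := by
      ext w
      have h4' := hB 4
      fin_cases w <;>
        simp [hBdef, bzDen, slotDown, BrownZudilin2022.b24, BrownZudilin2022.b14, BrownZudilin2022.b57,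
          BrownZudilin2022.b35, BrownZudilin2022.b36] at *
      all_goals omega
    have hu : dualSpanProd (Function.update (Function.update A 6 (A 6 + 1)) 4 ((bzNum a 4).toNat + 1)) =
        dualSpanProd (Function.update A 6 (A 6 + 1)) := DualCT.dualSpanProd_update4 _ _
    rw [hn, hd, hu]
  have key := coeff_star46 A B
  have c6 : (bzNum a 6 : ℤ) = (A 6 : ℤ) := by simp only [hAdef]; have := hA 6; omega
  have c3 : (bzDen a 3 : ℤ) = (B 3 : ℤ) := by
    simp only [hBdef, Finsupp.coe_equivFunOnFinite_symm]; have := hB 3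
    change bzDen a 3 = ((bzDen a 3).toNat : ℤ); omega
  have c4 : (bzDen a 4 : ℤ) = (B 4 : ℤ) := by
    simp only [hBdef, Finsupp.coe_equivFunOnFinite_symm]; have := hB 4
    change bzDen a 4 = ((bzDen a 4).toNat : ℤ); omega
  rw [e0, e6, e4, c6, c3, c4]
  exact key

/-- The same in gen-1's STAR(4,6) vocabulary: `κ(4,6)·CT(a) + χ₆Π₆·CT(a − s₆) − χ₄Π₄·CT(a − s₄) = 0`
(common factor `N + 1 − P₄ − P₆ = b₇ + 1`; two sign changes w.r.t. `DictStar` = the sign of `Q` flipping under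
both moves). -/
theorem dualConstantTerm_star46' (a : Fin 8 → ℤ) (hA : ∀ i, 0 ≤ bzNum a i) (hB : ∀ i, 0 ≤ bzDen a i) :
    starKappa (bOfA a) 4 6 * dualConstantTerm a + fanCoeff (bOfA a) 6 * dualConstantTerm (a + slotDown 6)
      - fanCoeff (bOfA a) 4 * dualConstantTerm (a + slotDown 4) = 0 := by
  have h := dualConstantTerm_star46 a hA hB
  have e1 : starKappa (bOfA a) 4 6 = (a 4 + a 5 - a 7 + 1) * (bzDen a 3 - bzNum a 6) := by
    simp [starKappa, BrownZudilin2022.bOfA, bzNum, bzDen]; ring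
  have e2 : fanCoeff (bOfA a) 6 = (a 4 + a 5 - a 7 + 1) * (bzDen a 3 + 1) := by
    simp [fanCoeff, WedgeDictionary.chiOf, WedgeDictionary.nonEdgePartners, BrownZudilin2022.bOfA, bzDen]; ring
  have e3 : fanCoeff (bOfA a) 4 = (a 4 + a 5 - a 7 + 1) * (bzDen a 4 + 1) := by
    simp [fanCoeff, WedgeDictionary.chiOf, WedgeDictionary.nonEdgePartners, BrownZudilin2022.bOfA, bzDen,
      BrownZudilin2022.b57]; ring
  rw [e1, e2, e3]
  linear_combination (a 4 + a 5 - a 7 + 1) * h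

end Summit.KontsevichZagierPeriods.Zeta5Search.Families.Cellular
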